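import Literature.NumberTheory.Automorphic.IwasawaHaarGL2
import Literature.NumberTheory.Automorphic.MatrixTwoConjugacy
import Literature.NumberTheory.Automorphic.QuaternionGLTwoClassesEmbedding
import Literature.NumberTheory.Automorphic.GLnCuspidalSpectrumProofs
import HarnessLib

/-!
# Elliptic classes of `GL₂(K)` at a place where the torus splits: the local component is conjugate
# to a regular diagonal matrix
(Gelbart, *Automorphic forms on adele groups* (1975), §10, p. 155, (10.20)/(10.22): the orbital
integral over `B_v \ G_v` "equals zero otherwise", i.e. when `γ` does not lie in a subfield of `D_v`,
equivalently when `E ⊗ K_v` is not a field)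

Topic `NumberTheory/Automorphic`; theorems only (no definition, no named fact, no instance).

In the comparison (10.14) = (10.15) the elliptic classes `[γ]` of `GL₂(K)` whose quadratic field
`E = K(γ)` does not embed in the division algebra `D` are those for which `E ⊗_K K_v` splits at some
place `v` ramified in `D` (Gelbart (10.17); `QuaternionGLTwoClassBijection`); at such a (finite)
place the local component `γ_v` of `γ` is a **split** regular semisimple element of `GL₂(K_v)`,
i.e. conjugate to a regular diagonal matrix, so that its local orbital integral of a supercusp form
vanishes (`GL2SplitTorusOrbitalVanishing`, Gelbart (10.22)). This file supplies the algebra: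

* `GL2.exists_eq_conj_diagGL2_of_sq_eq_discr` — over a field `L` with `2 ≠ 0`: if the discriminant
  `tr(γ)² - 4 det(γ)` of `γ ∈ GL₂(L)` is a **non-zero** square `s²`, then
  `γ = g · d(m₀, m₁) · g⁻¹` with `m₀ ≠ m₁` (the eigenvalues `(tr ± s)/2`; conjugacy of non-scalar
  `2 × 2` matrices by `(tr, det)`, `isConj_iff_trace_eq_and_det_eq` of `MatrixTwoConjugacy`).
* `GL2.discr_ne_zero_of_irreducible_charpoly` — an elliptic `γ ∈ GL₂(K)` (irreducible
  characteristic polynomial, `char K ≠ 2`) has non-zero discriminant.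
* `GL2.trace_map_ringHom`, `GL2.det_map_ringHom` — trace and determinant of the image of `γ`
  in `GL₂(L)` under `K → L`.
* `GL2.exists_map_eq_conj_diagGL2_of_isSquare` — **for an elliptic `γ ∈ GL₂(K)` and a field
  extension `L/K` (`char ≠ 2`) in which `tr(γ)² - 4 det(γ)` becomes a square, the image of `γ` in
  `GL₂(L)` is conjugate to a regular diagonal matrix** — with `L = K_v`: "`E ⊗ K_v` is not a field"
  ⇒ `γ_v` is split regular semisimple.
* `GLn.toLocalAt_gl_toAdelic` — the `v`-component of the diagonally embedded `γ ∈ GL_n(K)` is the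
  image of `γ` under `K → K_v` (`GLn.toLocalAt n K v ((gl n K).toAdelic γ) = GL.map (K → K_v) γ`), so
  that the previous statement applies to the local components of the tree's adelic datum.

Part of the inline (D-0026) decomposition of
`Literature.NumberTheory.Automorphic.strong_multiplicity_one_quaternionUnits` (Gelbart Thm. 10.5 via
(10.14) = (10.15): the vanishing of the `GL₂` elliptic terms not matched by `D^×`).

## References

* S. Gelbart, *Automorphic forms on adele groups*, Ann. of Math. Studies 83 (1975), §10, p. 155,
  (10.17), (10.20)–(10.22) [Gelbart1975].
-/

noncomputable section

open Matrix Polynomial NumberField IsDedekindDomain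

namespace Literature.NumberTheory.Automorphic

/-! ### Split regular semisimple elements of `GL₂(L)` are conjugate to regular diagonal matrices -/

section Local

variable {L : Type*} [Field L]

/-- A scalar matrix has zero discriminant: `tr(c·1)² - 4 det(c·1) = 0`. [folklore] -/
theorem GL2.discr_eq_zero_of_mem_bot {γ : Matrix (Fin 2) (Fin 2) L}
    (hγ : γ ∈ (⊥ : Subalgebra L (Matrix (Fin 2) (Fin 2) L))) : γ.trace ^ 2 - 4 * γ.det = 0 := by
  obtain ⟨c, rfl⟩ := Set.mem_range.1 (Algebra.mem_bot.1 hγ)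
  rw [Algebra.algebraMap_eq_smul_one, Matrix.trace_smul, Matrix.trace_one, Matrix.det_smul, Matrix.det_one,
    Fintype.card_fin]
  simp only [smul_eq_mul, mul_one]
  norm_num
  ring

/-- **A `2 × 2` invertible matrix whose discriminant is a non-zero square is conjugate to a regular
diagonal matrix**: if `tr(γ)² - 4 det(γ) = s²` with `s ≠ 0` (and `2 ≠ 0` in `L`) then
`γ = g · d(m₀, m₁) · g⁻¹` with `m₀ = (tr + s)/2 ≠ m₁ = (tr - s)/2` — both `γ` and `d(m₀, m₁)` are
non-scalar with the same trace and determinant (`isConj_iff_trace_eq_and_det_eq`). With `L = K_v`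
this is the local shape of the elliptic `γ ∈ GL₂(K)` at a place where `K(γ) ⊗ K_v` splits
(Gelbart (1975), p. 155, the case "`= 0` otherwise" of (10.20)). [cite: Gelbart1975, p. 155 (10.20)] -/
theorem GL2.exists_eq_conj_diagGL2_of_sq_eq_discr [NeZero (2 : L)] (γ : GL (Fin 2) L) {s : L} (hs : s ≠ 0)
    (hsq : (γ : Matrix (Fin 2) (Fin 2) L).trace ^ 2 - 4 * (γ : Matrix (Fin 2) (Fin 2) L).det = s ^ 2) :
    ∃ (m₀ m₁ : Lˣ) (g : GL (Fin 2) L), m₀ ≠ m₁ ∧ γ = g * diagGL2 m₀ m₁ * g⁻¹ := by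
  have h2 : (2 : L) ≠ 0 := NeZero.ne 2
  set t := (γ : Matrix (Fin 2) (Fin 2) L).trace with ht
  set n := (γ : Matrix (Fin 2) (Fin 2) L).det with hn
  have hn0 : n ≠ 0 := ((Matrix.isUnit_iff_isUnit_det _).1 γ.isUnit).ne_zero
  -- the eigenvalues
  set r₀ := (t + s) / 2 with hr₀
  set r₁ := (t - s) / 2 with hr₁
  have hsum : r₀ + r₁ = t := by rw [hr₀, hr₁]; field_simp; ring
  have hprod : r₀ * r₁ = n := by
    rw [hr₀, hr₁]
    field_simp
    linear_combination hsq
  have hr₀0 : r₀ ≠ 0 := fun h => hn0 (by rw [← hprod, h, zero_mul])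
  have hr₁0 : r₁ ≠ 0 := fun h => hn0 (by rw [← hprod, h, mul_zero])
  have hne : r₀ ≠ r₁ := by
    intro h
    apply hs
    have : r₀ - r₁ = s := by rw [hr₀, hr₁]; field_simp; ring
    rw [← this, h, sub_self]
  refine ⟨Units.mk0 r₀ hr₀0, Units.mk0 r₁ hr₁0, ?_⟩
  -- both matrices are non-scalar with the same trace and determinant
  have hγ : (γ : Matrix (Fin 2) (Fin 2) L) ∉ (⊥ : Subalgebra L (Matrix (Fin 2) (Fin 2) L)) := by
    intro hmem
    have h0 := GL2.discr_eq_zero_of_mem_bot hmem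
    rw [hsq] at h0
    exact hs (pow_eq_zero_iff (n := 2) (by norm_num) |>.1 h0)
  have hD : ((diagGL2 (Units.mk0 r₀ hr₀0) (Units.mk0 r₁ hr₁0) : GL (Fin 2) L) : Matrix (Fin 2) (Fin 2) L) ∉
      (⊥ : Subalgebra L (Matrix (Fin 2) (Fin 2) L)) := by
    rw [coe_diagGL2, matrixTwo_mem_bot_iff]
    rintro ⟨-, -, h⟩
    exact hne (by simpa using h)
  have htr : (γ : Matrix (Fin 2) (Fin 2) L).trace =
      ((diagGL2 (Units.mk0 r₀ hr₀0) (Units.mk0 r₁ hr₁0) : GL (Fin 2) L) : Matrix (Fin 2) (Fin 2) L).trace := by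
    rw [coe_diagGL2, Matrix.trace_fin_two_of, ← ht]
    exact hsum.symm
  have hdet : (γ : Matrix (Fin 2) (Fin 2) L).det =
      ((diagGL2 (Units.mk0 r₀ hr₀0) (Units.mk0 r₁ hr₁0) : GL (Fin 2) L) : Matrix (Fin 2) (Fin 2) L).det := by
    rw [coe_diagGL2, Matrix.det_fin_two_of, ← hn]
    simp only [Units.val_mk0, mul_zero, sub_zero]
    exact hprod.symm
  obtain ⟨g, hg⟩ := isConj_iff.1 ((isConj_iff_trace_eq_and_det_eq hγ hD).2 ⟨htr, hdet⟩)
  exact ⟨g, fun h => hne (by simpa using congrArg (fun u : Lˣ => (u : L)) h), hg.symm⟩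

end Local

section Map

variable {R S : Type*} [CommRing R] [CommRing S]

/-- The trace of the image of `γ` under a ring homomorphism applied entrywise. [folklore] -/
theorem GL2.trace_map_ringHom (f : R →+* S) (γ : GL (Fin 2) R) :
    ((Matrix.GeneralLinearGroup.map f γ : GL (Fin 2) S) : Matrix (Fin 2) (Fin 2) S).trace =
      f (γ : Matrix (Fin 2) (Fin 2) R).trace := by
  change ((γ : Matrix (Fin 2) (Fin 2) R).map f).trace = _
  rw [Matrix.trace_fin_two, Matrix.trace_fin_two, map_add]
  rfl

/-- The determinant of the image of `γ` under a ring homomorphism applied entrywise. [folklore] -/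
theorem GL2.det_map_ringHom (f : R →+* S) (γ : GL (Fin 2) R) :
    ((Matrix.GeneralLinearGroup.map f γ : GL (Fin 2) S) : Matrix (Fin 2) (Fin 2) S).det =
      f (γ : Matrix (Fin 2) (Fin 2) R).det := by
  change ((γ : Matrix (Fin 2) (Fin 2) R).map f).det = _
  rw [RingHom.map_det]
  rfl

end Map

/-! ### Elliptic elements of `GL₂(K)` split in an extension where the discriminant is a square -/

section Global

variable {K : Type*} [Field K]

/-- **An elliptic element has non-zero discriminant** (`char K ≠ 2`): if `charpoly γ = X² - tX + n` is
irreducible then `t² - 4n` is not a square (`irreducible_quadratic_iff_not_isSquare_discr`), in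
particular `≠ 0`. [folklore] -/
theorem GL2.discr_ne_zero_of_irreducible_charpoly [NeZero (2 : K)] {γ : Matrix (Fin 2) (Fin 2) K}
    (hirr : Irreducible γ.charpoly) : γ.trace ^ 2 - 4 * γ.det ≠ 0 := by
  intro h0
  rw [Matrix.charpoly_fin_two, irreducible_quadratic_iff_not_isSquare_discr] at hirr
  exact hirr ⟨0, by rw [h0, mul_zero]⟩

/-- **Elliptic over `K`, split over `L`**: for `γ ∈ GL₂(K)` with irreducible characteristic
polynomial and a field extension `L` of `K` (`char ≠ 2`) in which `tr(γ)² - 4 det(γ)` is a square,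
the image of `γ` in `GL₂(L)` is conjugate to a regular diagonal matrix:
`γ_L = g · d(m₀, m₁) · g⁻¹`, `m₀ ≠ m₁`. With `L = K_v`: at a place `v` where `K(γ) ⊗ K_v` is not a
field the local component of an elliptic class is split regular semisimple (Gelbart (1975),
(10.17)/(10.20)). [cite: Gelbart1975, p. 155 (10.20)] -/
theorem GL2.exists_map_eq_conj_diagGL2_of_isSquare {L : Type*} [Field L] [Algebra K L] [NeZero (2 : K)]
    [NeZero (2 : L)] (γ : GL (Fin 2) K) (hirr : Irreducible (γ : Matrix (Fin 2) (Fin 2) K).charpoly)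
    (hsq : IsSquare (algebraMap K L ((γ : Matrix (Fin 2) (Fin 2) K).trace ^ 2 - 4 * (γ : Matrix (Fin 2) (Fin 2) K).det))) :
    ∃ (m₀ m₁ : Lˣ) (g : GL (Fin 2) L), m₀ ≠ m₁ ∧
      Matrix.GeneralLinearGroup.map (algebraMap K L) γ = g * diagGL2 m₀ m₁ * g⁻¹ := by
  obtain ⟨s, hs⟩ := hsq
  have hs0 : s ≠ 0 := by
    intro h
    rw [h, mul_zero, map_eq_zero] at hs
    exact GL2.discr_ne_zero_of_irreducible_charpoly hirr hs
  refine GL2.exists_eq_conj_diagGL2_of_sq_eq_discr _ hs0 ?_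
  rw [GL2.trace_map_ringHom, GL2.det_map_ringHom, sq s, ← hs, map_sub, map_pow, map_mul, map_ofNat]

end Global

/-! ### The local components of the diagonally embedded `γ ∈ GL_n(K)` -/

section Adelic

variable (n : ℕ) (K : Type) [Field K] [NumberField K] (v : HeightOneSpectrum (𝓞 K))

/-- The `v`-component of the principal adele of `x ∈ K` is `x ∈ K_v`. [folklore] -/
theorem AdelicGroupData.adeleEval_algebraMap (x : K) :
    AdelicGroupData.adeleEval K v (algebraMap K (AdeleRing (𝓞 K) K) x) = algebraMap K (v.adicCompletion K) x := by
  rw [AdelicGroupData.adeleEval_apply]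
  change algebraMap K (FiniteAdeleRing (𝓞 K) K) x v = _
  rw [FiniteAdeleRing.algebraMap_apply]
  exact adicCompletion_coe_eq_algebraMap (𝓞 K) K v x

/-- **The `v`-component of the diagonally embedded `γ ∈ GL_n(K)` is the image of `γ` under
`K → K_v`**: `GLn.toLocalAt n K v ((gl n K).toAdelic γ) = GL.map (K → K_v) γ` (entrywise
`adeleEval_algebraMap`). [folklore] -/
theorem GLn.toLocalAt_gl_toAdelic (γ : GL (Fin n) K) :
    GLn.toLocalAt n K v ((AdelicGroupData.gl n K).toAdelic γ) =
      Matrix.GeneralLinearGroup.map (algebraMap K (v.adicCompletion K)) γ := by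
  refine Matrix.GeneralLinearGroup.ext fun i j => ?_
  change AdelicGroupData.adeleEval K v
      (algebraMap K (AdeleRing (𝓞 K) K) ((γ : Matrix (Fin n) (Fin n) K) i j)) =
    algebraMap K (v.adicCompletion K) ((γ : Matrix (Fin n) (Fin n) K) i j)
  exact AdelicGroupData.adeleEval_algebraMap K v _

end Adelic

end Literature.NumberTheory.Automorphic
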